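import Mathlib
import Summits.NavierStokesRegularity.NavierStokesRegularity.Theorems.TaoLadderRungTwoBreakOneShiftWindowPairStepAt
import Summits.NavierStokesRegularity.NavierStokesRegularity.Theorems.TaoLadderRungTwoBreakOneShiftWindowStepEndD
import Summits.NavierStokesRegularity.NavierStokesRegularity.Theorems.TaoLadderRungTwoBreakOneShiftWindowSlopeGrid
import HarnessLib

/-!
# The one-shift window system, XXXIX: THE STEP GRID FROM DYADIC DATA — a sequence of pair steps (part XXXIV) with
# per-step Booleans (step test, end-box ⊆ next start box, interval product `A_s ⊗ V_s ⊆ V_{s+1}`, `I ⊆ V_0`), each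
# meant to be evaluated in ITS OWN file by `native_decide`, and the two theorems the assembly needs: every rough
# realisation's run from the first box passes through every start box (C⁰ chain), and any two runs of the same
# realisation have ONE flow slope `U ∈ V_{S+1}` from time `0` to any time of the final (smeared) step (part XX
# `exists_gridSlope` fed by parts XXXVI/XXXVIII) (cell harvest/h2-tao-ladder, seat p2; rung1/KERNEL-CHEAP-REPLAY-SPEC.md
# §2 (g)/(h), §7 (R4), §8; support for K1(1) = `NoSurvivingDSSOne`, stmt-NavierStokesRegularity-20205)

MODEL lattice ODEs only (Tao 2016 §4 normal form on Tao's shift set `S`); nothing here is a statement about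
the Navier–Stokes equations; no item is closed; no instance is evaluated here. Generic in `ι`, `κ`.

* `GridD (prec n S step V)`: `step s : PairStepD` (`s < S` regular, `s = S` the final step whose `hD` is the maximal
  final length), `V s` (`s ≤ S+1`) interval matrices (column-major `n × n`); grid times `t 0 = 0`, `t (s+1) = t s + h_s`;
* Booleans `stepOK s` (the pair test + `n` consistency), `linkOK s` (`endBoxR_s(h_s) ⊆ W_{s+1}`), `initOK` (`I ⊆ V_0`),
  `prodOK s` (`A_s ⊗ V_s ⊆ V_{s+1}`, `A_s = [VV_s.lo − Ẑ₂, VV_s.hi + Ẑ₂]`);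
* `mem_start_of_grid` — the C⁰ chain; `exists_flowSlope_of_grid` — the flow slope.
-/

-- the sub-problem namespace repeats the summit name by design (D-0017)
set_option linter.dupNamespace false

namespace Summit.NavierStokesRegularity.NavierStokesRegularity.Theorems

namespace DSSOneShift

open Set Finset Metric Filter Topology TopologicalSpace
open Literature.Analysis.ODE
open Summit.NavierStokesRegularity.NavierStokesRegularity.Theorems.TaylorModelCert
open Summit.NavierStokesRegularity.NavierStokesRegularity.Theorems.TaylorModelReadout
open Summit.NavierStokesRegularity.NavierStokesRegularity.Theorems.CertificateGlueOn

/-! ### Data and Booleans -/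

/-- **The dyadic data of a step grid.** [cite: Tao2016AveragedNS, §5.3; cell vocabulary, harvest/h2-tao-ladder rung1/KERNEL-CHEAP-REPLAY-SPEC.md §2 (g)/(h)] -/
structure GridD where
  /-- mantissa bits for the products -/
  prec : ℕ
  /-- number of physical coordinates -/
  n : ℕ
  /-- number of regular steps (`step S` is the final step) -/
  S : ℕ
  /-- the steps -/
  step : ℕ → PairStepD
  /-- the product enclosures `V s`, `s ≤ S + 1` -/
  V : ℕ → Array IntervalD

namespace GridD

variable (g : GridD)

/-- Step length `h_s`. [folklore] -/
def h (s : ℕ) : Dyad := (g.step s).hD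

/-- Grid time `t s = Σ_{r<s} h_r`. [folklore] -/
noncomputable def t (s : ℕ) : ℝ := ((List.range s).map fun r => (g.h r).toReal).sum

/-- `t 0 = 0`. [folklore] -/
@[simp] theorem t_zero : g.t 0 = 0 := by simp [t]

/-- `t (s+1) = t s + h s`. [folklore] -/
theorem t_succ (s : ℕ) : g.t (s + 1) = g.t s + (g.h s).toReal := by
  simp [t, List.range_succ, List.map_append, List.sum_append]

/-- Entry `(i,l)` of `A_s = [VV_s.lo − Ẑ₂, VV_s.hi + Ẑ₂]`. [folklore] -/
def Aent (s i l : ℕ) : IntervalD :=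
  ⟨((g.step s).toRoughStepD.centre.vv i l).lo.sub ((g.step s).mget (g.step s).Zh2 i l),
    ((g.step s).toRoughStepD.centre.vv i l).hi.add ((g.step s).mget (g.step s).Zh2 i l)⟩

/-- Entry `(i,l)` of `V_s`. [folklore] -/
def Vent (s i l : ℕ) : IntervalD := IntervalD.aget (g.V s) (l * g.n + i)

/-- Entry `(i,l)` of `A_s ⊗ V_s`. [cite: Neumaier1991, §3.1 Proposition 3.1.2 (6)] -/
def prodEnt (s i l : ℕ) : IntervalD :=
  IntervalD.rangeSumR g.prec (fun j => IntervalD.mulR g.prec (g.Aent s i j) (g.Vent s j l)) g.n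

/-- Per-step test: the pair test and the dimension. [folklore] -/
def stepOK (s : ℕ) : Bool := (g.step s).check && decide ((g.step s).n = g.n)

/-- Link test: the rough end box of step `s` (at its full length) lies in the start box of step `s+1`. [folklore] -/
def linkOK (s : ℕ) : Bool :=
  (List.range g.n).all fun c => IntervalD.subset ((g.step s).toRoughStepD.endBoxR (g.h s) c) (IntervalD.aget (g.step (s + 1)).W c)

/-- Product test: `A_s ⊗ V_s ⊆ V_{s+1}`. [folklore] -/
def prodOK (s : ℕ) : Bool :=
  (List.range g.n).all fun i => (List.range g.n).all fun l => IntervalD.subset (g.prodEnt s i l) (g.Vent (s + 1) i l)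

/-- Initial test: `I ⊆ V_0`. [folklore] -/
def initOK : Bool :=
  (List.range g.n).all fun i => (List.range g.n).all fun l =>
    IntervalD.subset (if i = l then IntervalD.ofInt 1 else IntervalD.ofInt 0) (g.Vent 0 i l)

/-! ### Unpacking -/

/-- `linkOK`. [folklore] -/
theorem of_linkOK {s : ℕ} (h : g.linkOK s = true) : ∀ c < g.n,
    IntervalD.subset ((g.step s).toRoughStepD.endBoxR (g.h s) c) (IntervalD.aget (g.step (s + 1)).W c) = true := by
  unfold linkOK at h; simpa [List.all_eq_true, List.mem_range] using h

/-- `prodOK`. [folklore] -/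
theorem of_prodOK {s : ℕ} (h : g.prodOK s = true) : ∀ i < g.n, ∀ l < g.n,
    IntervalD.subset (g.prodEnt s i l) (g.Vent (s + 1) i l) = true := by
  unfold prodOK at h; simpa [List.all_eq_true, List.mem_range] using h

/-- `initOK`. [folklore] -/
theorem of_initOK (h : g.initOK = true) : ∀ i < g.n, ∀ l < g.n,
    IntervalD.subset (if i = l then IntervalD.ofInt 1 else IntervalD.ofInt 0) (g.Vent 0 i l) = true := by
  unfold initOK at h; simpa [List.all_eq_true, List.mem_range] using h

/-- `t` is monotone along non-negative steps. [folklore] -/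
theorem t_mono {r s : ℕ} (hrs : r ≤ s) (hh : ∀ k < s, 0 ≤ (g.h k).toReal) : g.t r ≤ g.t s := by
  induction s, hrs using Nat.le_induction with
  | base => exact le_rfl
  | succ s hrs ih =>
    rw [t_succ]
    have := ih fun k hk => hh k (Nat.lt_succ_of_lt hk)
    linarith [hh s (Nat.lt_succ_self s)]

/-- Grid times are non-negative along non-negative steps. [folklore] -/
theorem t_nonneg {s : ℕ} (hh : ∀ k < s, 0 ≤ (g.h k).toReal) : 0 ≤ g.t s := by
  have := g.t_mono (Nat.zero_le s) hh; simpa using this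

/-- End times are monotone. [folklore] -/
theorem t_add_le {r s : ℕ} (hrs : r ≤ s) (hh : ∀ k ≤ s, 0 ≤ (g.h k).toReal) :
    g.t r + (g.h r).toReal ≤ g.t s + (g.h s).toReal := by
  rw [← t_succ, ← t_succ]
  exact g.t_mono (Nat.succ_le_succ hrs) fun k hk => hh k (Nat.le_of_lt_succ hk)

/-! ### Soundness -/

section Sound

variable {ι : Type*} [Fintype ι] [DecidableEq ι] {κ : Type*} [Fintype κ]

/-- The numbering of step `s` (equal dimensions). [folklore] -/
def es (e : ι ≃ Fin g.n) (hn : ∀ s, (g.step s).n = g.n) (s : ℕ) : ι ≃ Fin (g.step s).n :=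
  e.trans (finCongr (hn s).symm)

omit [Fintype ι] [DecidableEq ι] in
/-- Its values are those of `e`. [folklore] -/
@[simp] theorem es_val (e : ι ≃ Fin g.n) (hn : ∀ s, (g.step s).n = g.n) (s : ℕ) (i : ι) :
    ((g.es e hn s i : Fin (g.step s).n) : ℕ) = (e i : ℕ) := by
  simp [es, finCongr_apply]

omit [Fintype ι] [DecidableEq ι] in
/-- Boxes read through `es` are boxes read through `e`. [folklore] -/
theorem boxOf_es (e : ι ≃ Fin g.n) (hn : ∀ s, (g.step s).n = g.n) (s : ℕ) (A : Array IntervalD) :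
    boxOf (g.es e hn s) A = boxOf e A := by
  funext i; simp [boxOf, es_val]

/-- **THE C⁰ CHAIN**: a run of a rough realisation from the first start box on `[0, T]`, `t S + h_S ≤ T`, with all
step tests and link tests passed, is in the start box of every step at its grid time. [cite: Moore1979, §8.1 eq. (8.13) (continuation over steps); cell vocabulary, harvest/h2-tao-ladder rung1/KERNEL-CHEAP-REPLAY-SPEC.md §2 (h)] -/
theorem mem_start_of_grid (e : ι ≃ Fin g.n) (hn : ∀ s, (g.step s).n = g.n)
    {Tc : ℕ → κ → BTerm ι} {Tf : ℝ → κ → BTerm ι} {rows : ι → List κ}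
    (hRDc : ∀ s ≤ g.S, IsRTEncl (g.es e hn s) (Tc s) (Tc s) rows (g.step s).RD)
    (hRD : ∀ s ≤ g.S, ∀ r ∈ Ico 0 (g.h s).toReal, IsRTEncl (g.es e hn s) (Tc s) (Tf (g.t s + r)) rows (g.step s).RD)
    (hstep : ∀ s ≤ g.S, g.stepOK s = true) (hlink : ∀ s < g.S, g.linkOK s = true)
    {T : ℝ} (hT : g.t g.S + (g.h g.S).toReal ≤ T) {a : ι → ℝ} (ha : a ∈ boxSet (boxOf e (g.step 0).W))
    {Su : ℝ → ι → ℝ} (hSu0 : Su 0 = a)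
    (hSu : ∀ t ∈ Icc 0 T, HasDerivWithinAt Su (termField (Tf t) (Su t)) (Icc 0 T) t) :
    ∀ s ≤ g.S, Su (g.t s) ∈ boxSet (boxOf e (g.step s).W) := by
  have hchk : ∀ s ≤ g.S, (g.step s).check = true := fun s hs => by
    have := hstep s hs
    simp only [stepOK, Bool.and_eq_true, decide_eq_true_eq] at this
    exact this.1
  have hh : ∀ s, s ≤ g.S → 0 ≤ (g.h s).toReal := fun s hs => by
    have hc' : (g.step s).toRoughStepD.check = true ∧ (g.step s).checkPair = true := by
      simpa [PairStepD.check, Bool.and_eq_true] using hchk s hs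
    have hrc' : (g.step s).toRoughStepD.centre.check = true ∧ (g.step s).toRoughStepD.checkKZ = true := by
      simpa [RoughStepD.check, Bool.and_eq_true] using hc'.1
    exact ((g.step s).toRoughStepD.centre.of_checkWith (by rw [← CentreStepD.check_eq]; exact hrc'.1)).2.1
  intro s
  induction s with
  | zero => intro _; simpa [hSu0] using ha
  | succ s ih =>
    intro hs
    have hs' : s < g.S := Nat.lt_of_succ_le hs
    have hmem := ih hs'.le
    -- the re-clocked run on step `s`
    have hts0 : 0 ≤ g.t s := g.t_nonneg fun k hk => hh k (by omega)
    have htsT : g.t s + (g.h s).toReal ≤ T := (g.t_add_le hs'.le fun k hk => hh k hk).trans hT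
    have hrun : ∀ r ∈ Icc 0 (g.h s).toReal,
        HasDerivWithinAt (fun r => Su (g.t s + r)) (termField (Tf (g.t s + r)) (Su (g.t s + r))) (Icc 0 (g.h s).toReal) r :=
      fun r hr => hasDerivWithinAt_shift (S := Su) (S' := fun t => termField (Tf t) (Su t)) hSu hts0 htsT hr
    have hc' : (g.step s).toRoughStepD.check = true := by
      have : (g.step s).toRoughStepD.check = true ∧ (g.step s).checkPair = true := by
        simpa [PairStepD.check, Bool.and_eq_true] using hchk s hs'.le
      exact this.1
    have hmem' : Su (g.t s) ∈ boxSet (boxOf (g.es e hn s) (g.step s).W) := by rwa [boxOf_es]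
    have hend := (g.step s).toRoughStepD.end_mem (g.es e hn s) (hRDc s hs'.le) (hRD s hs'.le) hc' hmem'
      (Su := fun r => Su (g.t s + r)) (by simp) hrun (tD := g.h s) ⟨hh s hs'.le, le_rfl⟩
    have hlk := g.of_linkOK (hlink s hs')
    rw [mem_boxSet_iff]
    intro i
    have hi := hend i
    simp only [es_val] at hi
    have hsub := hlk (e i) (e i).isLt
    have := IntervalD.mem_of_subset hsub hi
    rw [t_succ]
    exact mem_toNI this

end Sound

end GridD

end DSSOneShift

end Summit.NavierStokesRegularity.NavierStokesRegularity.Theorems
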